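import Summits.ResolutionOfSingularities.ResolutionOfSingularities.Theorems.WeightedInvariantIotaSqueeze
import Summits.ResolutionOfSingularities.ResolutionOfSingularities.Theorems.WeightedInvariantELadderTwoGenSingNonempty
import Summits.ResolutionOfSingularities.ResolutionOfSingularities.Theorems.WeightedInvariantHypersurfaceLocalGameEFT4SDimLEDoorGradedHom
import HarnessLib

/-!
# Door assembly H2c″ — the SQUEEZE LEMMA in the door setting at Krull dimension `≤ d`: (c7)≤d,p along specialisations,
# and its e = 2 reading (step (d) of LEMMA H for the word (G-6b) `e2CentreHom`)

Route `ResolutionOfSingularities/WeightedInvariant`, crux `Theses.WeightedInvariant.HypersurfaceCentreConstruction`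
(stmt-ResolutionOfSingularities-19897), door line `local-engine` (skeleton v3.12), E2 tier: registered stub `stub_e2_centre_h` rests on
the single word (G-6b) `PRungGrHomLE 3 p ι J → E2HomogeneousChartBody p ι J → E2CentreHomBody p ι J` (`…ELadderTwoCentreOfHom`),
whose proof route «LEMMA H» (`Cruxes/HypersurfaceCentreConstruction/G6B-LEMMA-H.md`, step (d)) reads the RESTRICTED clause (c7)≤3,p
`IotaGenerizationMonotoneLE 3 p ι` — a conjunct of the rung `PRungGrHomLE 3 p ι J` — along a specialisation `y ⤳ η` of a point `η`
of `genSing₂` (ambient stalk regular of dimension `≤ 3`).  The tree's squeeze lemma `iotaAt_le_of_specializes` (`…IotaSqueeze`) asks for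
the UNRESTRICTED (c7) `IotaGenerizationMonotone ι`, which the rung does not supply.  This file gives the door-setting versions:
* `iota_localization_le_of_le_LE` — (c7)≤d,p between two primes `𝔮' ≤ 𝔮` of a finite-type algebra `A` over a perfect field of
  characteristic `p`, `A_𝔮` regular of dimension `≤ d`;
* `iotaAt_le_of_specializes_LE` — for `Y` smooth over a perfect field of characteristic `p`, `X` locally principal, `y' ⤳ y` with
  `dim 𝒪_{Y,y} ≤ d`: `iotaAt ι X y' ≤ iotaAt ι X y` ((c6) + (c7)≤d,p + (c12a));
* the e = 2 reading under the graded HOM rung: `Stage.iotaAt_le_of_specializes_genSing₂` (a generisation of a read point has `ι ≤` the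
  read point's), `Stage.iotaAt_le_mu₂_of_specializes_genSing₂`, and the SANDWICH `Stage.mem_maxLocus₂_of_specializes_of_mu₂_le`: a read
  point `η ∈ genSing₂` with a generisation `y ⤳ η` carrying `mu₂ ≤ ι(y)` lies in `maxLocus₂` — LEMMA H's step «`mu₂ = ι(η**) ≤ ι(η_u) ≤ mu₂`».
Def-free helper (`--supports stmt-ResolutionOfSingularities-19897`); nothing here asserts any clause or anything about resolution of
singularities in characteristic `p`; AI-written, weaker than expert review. [OURS · L1 W4.3]
-/

noncomputable section

set_option linter.dupNamespace false -- mandated namespace of this single-conjunct summit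

open CategoryTheory AlgebraicGeometry TopologicalSpace IsLocalRing Topology
open Literature.AlgebraicGeometry.Resolution
open Summit.ResolutionOfSingularities.ResolutionOfSingularities.Theorems

namespace Summit.ResolutionOfSingularities.ResolutionOfSingularities.Cruxes.HypersurfaceCentreConstruction.LocalEngine

variable (ι : (R : Type) → [CommRing R] → R → Ordinal.{0})

/-! ## Commutative algebra: (c7)≤d,p between two primes `𝔮' ≤ 𝔮` of a finite-type algebra with regular `A_𝔮` of dimension `≤ d` -/

section TwoPrimes

variable {d p : ℕ} {A : Type} [CommRing A]

/-- **(c7)≤d,p between two primes.**  If `𝔮' ≤ 𝔮` are primes of a finite-type algebra `A` over a perfect field of characteristic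
`p`, with `A_𝔮` a regular local ring of Krull dimension `≤ d`, and `ι` satisfies (c6) and (c7)≤d,p, then
`ι(A_{𝔮'}, F/1) ≤ ι(A_𝔮, F/1)`: `A_{𝔮'}` is (isomorphic over `A` to) the localisation of `A_𝔮` at the prime `𝔮'A_𝔮`, and `A_𝔮` is
essentially of finite type over the field. [folklore] -/
theorem iota_localization_le_of_le_LE (hc6 : IotaIsoInvariant ι) (hc7 : IotaGenerizationMonotoneLE d p ι)
    (k₀ : Type) [Field k₀] [CharP k₀ p] [PerfectField k₀] [Algebra k₀ A] [Algebra.FiniteType k₀ A]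
    {𝔮 𝔮' : Ideal A} [𝔮.IsPrime] [𝔮'.IsPrime] (hle : 𝔮' ≤ 𝔮)
    [IsRegularLocalRing (Localization.AtPrime 𝔮)] (hd : ringKrullDim (Localization.AtPrime 𝔮) ≤ d) (F : A) :
    ι (Localization.AtPrime 𝔮') (algebraMap A (Localization.AtPrime 𝔮') F) ≤
      ι (Localization.AtPrime 𝔮) (algebraMap A (Localization.AtPrime 𝔮) F) := by
  -- the prime `𝔭 = 𝔮' A_𝔮` of `S = A_𝔮`
  set S := Localization.AtPrime 𝔮 with hS
  have hdisj : Disjoint (𝔮.primeCompl : Set A) (𝔮' : Set A) := by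
    rw [Set.disjoint_left]
    intro a ha ha'
    exact ha (hle ha')
  set 𝔭 : Ideal S := 𝔮'.map (algebraMap A S) with h𝔭
  haveI h𝔭p : 𝔭.IsPrime := IsLocalization.isPrime_of_isPrime_disjoint 𝔮.primeCompl S 𝔮' ‹_› hdisj
  have hunder : 𝔭.under A = 𝔮' := IsLocalization.under_map_of_isPrime_disjoint 𝔮.primeCompl S ‹_› hdisj
  -- `Localization.AtPrime 𝔭` is a localisation of `A` at `𝔮'`
  have hM : (𝔭.under A).primeCompl = 𝔮'.primeCompl := by
    ext a
    simp only [Ideal.mem_primeCompl_iff, hunder]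
  haveI : IsLocalization 𝔮'.primeCompl (Localization.AtPrime 𝔭) := by
    rw [← hM]
    exact IsLocalization.isLocalization_isLocalization_atPrime_isLocalization 𝔮.primeCompl
      (Localization.AtPrime 𝔭) 𝔭
  let e : Localization.AtPrime 𝔮' ≃ₐ[A] Localization.AtPrime 𝔭 :=
    IsLocalization.algEquiv 𝔮'.primeCompl (Localization.AtPrime 𝔮') (Localization.AtPrime 𝔭)
  have he : e (algebraMap A (Localization.AtPrime 𝔮') F) =
      algebraMap S (Localization.AtPrime 𝔭) (algebraMap A S F) := by
    rw [AlgEquiv.commutes, IsScalarTower.algebraMap_apply A S (Localization.AtPrime 𝔭)]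
  -- (c6) along `e`, then (c7)≤d,p in the regular local ring `S`, essentially of finite type over `k₀`
  have h6 : ι (Localization.AtPrime 𝔭) (e (algebraMap A (Localization.AtPrime 𝔮') F)) =
      ι (Localization.AtPrime 𝔮') (algebraMap A (Localization.AtPrime 𝔮') F) :=
    hc6 _ _ e.toRingEquiv (algebraMap A (Localization.AtPrime 𝔮') F)
  haveI : Algebra.EssFiniteType A S := Algebra.EssFiniteType.of_isLocalization S 𝔮.primeCompl
  haveI : Algebra.EssFiniteType k₀ S := Algebra.EssFiniteType.comp k₀ A S
  rw [← h6, he]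
  exact hc7 k₀ S 𝔭 (algebraMap A S F) hd

end TwoPrimes

/-! ## (c7)≤d,p along specialisations of points of a smooth scheme -/

section Specializes

variable {d p : ℕ} {k : Type} [Field k] [CharP k p] [PerfectField k] {Y : Scheme.{0}} (f : Y ⟶ Spec (.of k))

/-- **(a)≤d `ι` along specialisations, door setting.**  For `Y` smooth over a perfect field of characteristic `p`, `X` a locally
principal ideal sheaf and `ι` with (c6) iso-invariance, (c7)≤d,p and (c12a) unit-invariance: if `y' ⤳ y` (`y` lies in the closure
of `y'`) and `dim 𝒪_{Y,y} ≤ d` then `iotaAt ι X y' ≤ iotaAt ι X y`. [folklore] -/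
theorem iotaAt_le_of_specializes_LE (hc6 : IotaIsoInvariant ι) (hc7 : IotaGenerizationMonotoneLE d p ι)
    (hu : IotaUnitInvariant ι) [Smooth f] (X : Y.IdealSheafData) (hX : IsLocallyPrincipal X) {y y' : Y}
    (h : y' ⤳ y) (hd : ringKrullDim (Y.presheaf.stalk y) ≤ d) : iotaAt ι X y' ≤ iotaAt ι X y := by
  -- a principal affine chart through `y`, hence through `y'`
  obtain ⟨U, hyU, F, hF⟩ := hX y
  have hy'U : y' ∈ (U : Y.Opens) := h.mem_open U.1.isOpen hyU
  rw [iotaAt_eq_iota_localization ι (hy := hyU) f hc6 hu X hF,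
    iotaAt_eq_iota_localization ι (hy := hy'U) f hc6 hu X hF]
  -- `Γ(Y, U)` is of finite type over `k`
  have hft : RingHom.FiniteType (f.appLE ⊤ U le_top).hom :=
    HasRingHomProperty.appLE @LocallyOfFiniteType f inferInstance ⟨⊤, isAffineOpen_top _⟩ U le_top
  let φ : k →+* Γ(Y, U) := (f.appLE ⊤ U le_top).hom.comp (Scheme.ΓSpecIso (.of k)).inv.hom
  have hφ : φ.FiniteType :=
    hft.comp (RingHom.FiniteType.of_surjective _
      (Scheme.ΓSpecIso (.of k)).commRingCatIsoToRingEquiv.symm.surjective)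
  letI : Algebra k Γ(Y, U) := φ.toAlgebra
  haveI : Algebra.FiniteType k Γ(Y, U) := hφ
  -- `Γ(Y,U)_𝔮 ≅ 𝒪_{Y,y}` is regular local (`Y` smooth over a field) of dimension `≤ d`
  haveI : IsRegularLocalRing (Y.presheaf.stalk y) := isRegularLocalRing_stalk_of_smooth_of_field f y
  haveI : IsRegularLocalRing (Localization.AtPrime (U.2.primeIdealOf ⟨y, hyU⟩).asIdeal) :=
    IsRegularLocalRing.of_ringEquiv (stalkEquiv U hyU).symm
  have hd' : ringKrullDim (Localization.AtPrime (U.2.primeIdealOf ⟨y, hyU⟩).asIdeal) ≤ d := by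
    rw [ringKrullDim_eq_of_ringEquiv (stalkEquiv U hyU)]
    exact hd
  exact iota_localization_le_of_le_LE ι hc6 hc7 k (primeIdealOf_le_of_specializes U hyU hy'U h) hd' F

end Specializes

end Summit.ResolutionOfSingularities.ResolutionOfSingularities.Cruxes.HypersurfaceCentreConstruction.LocalEngine

/-! ## The e = 2 reading under the graded HOM rung (LEMMA H, step (d)) -/

namespace Summit.ResolutionOfSingularities.ResolutionOfSingularities.Theorems.ELadderOne.Stage

open Summit.ResolutionOfSingularities.ResolutionOfSingularities.Cruxes.HypersurfaceCentreConstruction.LocalEngine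

variable {k : Type} [Field k] (S : Stage k) {p : ℕ} (ι : (R : Type) → [CommRing R] → R → Ordinal.{0})
  (J : (R : Type) → [CommRing R] → R → ℕ → Ideal R)

/-- **A generisation of a read point has `ι` at most the read point's** (under the graded HOM rung: (c6), (c7)≤3,p, (c12a); the
ambient stalk at a point of `genSing₂` has dimension `≤ 3`). [folklore] -/
theorem iotaAt_le_of_specializes_genSing₂ [CharP k p] [PerfectField k] (hr : PRungGrHomLE 3 p ι J)
    {y η : S.Y} (hη : η ∈ S.genSing₂) (h : y ⤳ η) : iotaAt ι S.i.ker y ≤ iotaAt ι S.i.ker η :=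
  iotaAt_le_of_specializes_LE ι S.f hr.1.1 hr.1.2.1 hr.1.2.2.2.2.2.2.2.2.1 S.i.ker S.isLocallyPrincipal h hη.2.2

/-- **A generisation of a read point has `ι ≤ mu₂`** (under the graded HOM rung). [folklore] -/
theorem iotaAt_le_mu₂_of_specializes_genSing₂ [CharP k p] [PerfectField k] (hr : PRungGrHomLE 3 p ι J)
    {y η : S.Y} (hη : η ∈ S.genSing₂) (h : y ⤳ η) : iotaAt ι S.i.ker y ≤ S.mu₂ ι :=
  (S.iotaAt_le_of_specializes_genSing₂ ι J hr hη h).trans (S.iotaAt_le_mu₂ ι hη)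

/-- **LEMMA H, step (d) — the sandwich `mu₂ ≤ ι(y) ≤ ι(η) ≤ mu₂`**: under the graded HOM rung, a read point `η ∈ genSing₂` admitting a
generisation `y ⤳ η` with `mu₂ ≤ ι(y)` lies in the maximum locus `maxLocus₂`, and `ι(y) = mu₂`. [folklore] -/
theorem mem_maxLocus₂_of_specializes_of_mu₂_le [CharP k p] [PerfectField k] (hr : PRungGrHomLE 3 p ι J)
    {y η : S.Y} (hη : η ∈ S.genSing₂) (h : y ⤳ η) (hμ : S.mu₂ ι ≤ iotaAt ι S.i.ker y) :
    η ∈ S.maxLocus₂ ι ∧ iotaAt ι S.i.ker y = S.mu₂ ι :=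
  have h1 := S.iotaAt_le_of_specializes_genSing₂ ι J hr hη h
  ⟨⟨hη, le_antisymm (S.iotaAt_le_mu₂ ι hη) (hμ.trans h1)⟩,
    le_antisymm (h1.trans (S.iotaAt_le_mu₂ ι hη)) hμ⟩

/-- **LEMMA H, step (d), equality form**: a point `y` with `ι(y) = mu₂` that specialises to a read point `η ∈ genSing₂` puts `η`
in `maxLocus₂` (under the graded HOM rung). [folklore] -/
theorem mem_maxLocus₂_of_specializes_of_iotaAt_eq [CharP k p] [PerfectField k] (hr : PRungGrHomLE 3 p ι J)
    {y η : S.Y} (hη : η ∈ S.genSing₂) (h : y ⤳ η) (hy : iotaAt ι S.i.ker y = S.mu₂ ι) : η ∈ S.maxLocus₂ ι :=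
  (S.mem_maxLocus₂_of_specializes_of_mu₂_le ι J hr hη h hy.ge).1

end Summit.ResolutionOfSingularities.ResolutionOfSingularities.Theorems.ELadderOne.Stage

end
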